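import Literature.RepresentationTheory.HeisenbergGroup.MetaplecticSumStrippingRight
import HarnessLib

/-!
# Sum-stripping for the RIGHT summand as a homomorphism: `rightSummandMp →* S̃p_ψ(W_{T₂})` and undoubling along `g ↦ 1 ⊕ φ(g)`

Topic `RepresentationTheory/HeisenbergGroup`; namespace `Literature.RepresentationTheory.HeisenbergGroup`.  KERNEL
only (definitions with bodies + theorems; no named fact, no `sorry`).  The mirror image of
`MetaplecticSumStripping` §3 (left summand: `leftSummandMp`, `strip`, `stripHom`, `undouble`) for the SECOND summand
of `W_T = W_{T₁} ⊕ W_{T₂}` (`T = reindex e e (T₁ ⊕ T₂)`), built on `MetaplecticSumStrippingRight`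
(`exists_strip_of_proj_eq_spInr`, `strip_unique_right`):

* `rightSummandMp` — the pairs of `S̃p_ψ(W_T)` over `1 ⊕ Sp(W_{T₂})`; `rightProj`, `spInr_rightProj`;
* `stripRight p ∈ S̃p_ψ(W_{T₂})` with `π(stripRight p) = rightProj p`, `1 ⊕ π(stripRight p) = π p` and
  **`ω(p)(f₁ ⊠ f₂) = f₁ ⊠ ω(stripRight p) f₂`** (`toRep_apply_boxSB_right`); uniqueness `eq_stripRight`,
  multiplicativity `stripRight_mul`, the homomorphism **`stripRightHom : rightSummandMp →* S̃p_ψ(W_{T₂})`**;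
* **`undoubleRight`**: a homomorphism `s : G →* S̃p_ψ(W_T)` over `g ↦ 1 ⊕ φ(g)` strips to `G →* S̃p_ψ(W_{T₂})` over
  `φ` (`proj_undoubleRight`), with `ω(s g)(f₁ ⊠ f₂) = f₁ ⊠ ω(undoubleRight s g) f₂` (`toRep_apply_boxSB_undoubleRight`).

[MoeglinVignerasWaldspurger1987, Chap. 2 II.1 Rem. (6)]: the metaplectic representation of `W₁ ⊕ W₂` restricted to
the preimage of `Sp(W₁) × Sp(W₂)` is the outer tensor product of the two metaplectic representations; [Kudla1984, §1].

Consumer: restriction of a local theta section of `U(V₁ ⊥ V₂)(F_v)` to `U(V₂)(F_v)` (route R for row IV-4c3 of the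
Hodge/COR-CM interface).  HC_CM is NOT proved here.

## References
* [MoeglinVignerasWaldspurger1987] C. Mœglin, M.-F. Vignéras, J.-L. Waldspurger, LNM 1291 (1987), Chap. 2 II.1 Rem. (6).
* [Kudla1984] S. Kudla, *Seesaw dual reductive pairs*, Progr. Math. 46 (1984), §1.
-/

set_option autoImplicit false

noncomputable section

open scoped TensorProduct

namespace Literature.RepresentationTheory.HeisenbergGroup

open Literature.NumberTheory.Automorphic
open Literature.NumberTheory.GaloisRepresentations.IsNonarchimedeanLocalField

section Strip

variable {K : Type*} [Field K] [ValuativeRel K] [TopologicalSpace K] [IsNonarchimedeanLocalField K]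
  [Invertible (2 : K)] {ι₁ ι₂ ι : Type*} [Fintype ι₁] [Fintype ι₂] [Fintype ι]
  [DecidableEq ι₁] [DecidableEq ι₂] [DecidableEq ι]
  (e : ι₁ ⊕ ι₂ ≃ ι) (T₁ : Matrix ι₁ ι₁ K) (T₂ : Matrix ι₂ ι₂ K) {T : Matrix ι ι K}
  (hT : T = Matrix.reindex e e (Matrix.fromBlocks T₁ 0 0 T₂)) (hT₁ : IsUnit T₁.det)
  {ψ : AddChar K Circle} (hl : IsLocallyConstant (⇑ψ : K → Circle)) (hψ : ψ.IsContinuousNontrivial)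
  (hb₁ : ∀ y : ι₁ → K, Continuous fun u : ι₁ → K => Matrix.toLinearMap₂' K T₁ u y)
  (hb₂ : ∀ y : ι₂ → K, Continuous fun u : ι₂ → K => Matrix.toLinearMap₂' K T₂ u y)
  (hb : ∀ y : ι → K, Continuous fun u : ι → K => Matrix.toLinearMap₂' K T u y)

local notation "SB" => SchwartzBruhat (ι → K)
local notation "SB₁" => SchwartzBruhat (ι₁ → K)
local notation "SB₂" => SchwartzBruhat (ι₂ → K)
local notation "ρT" => schrodingerSB (Matrix.toLinearMap₂' K T) ψ hl hb
local notation "ρ₂" => schrodingerSB (Matrix.toLinearMap₂' K T₂) ψ hl hb₂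
local notation "Sp₂" => symplecticGroup (polar (Matrix.toLinearMap₂' K T₂))
local notation "SpT" => symplecticGroup (polar (Matrix.toLinearMap₂' K T))

/-- **the pairs of `S̃p_ψ(W_T)` over `1 ⊕ Sp(W_{T₂})`.** [cite: Kudla1984, §1] -/
def rightSummandMp : Subgroup (MpPsi ρT) := (spInr e T₁ T₂ hT).range.comap (MpPsi.proj ρT)

/-- membership: `p` lies over some `1 ⊕ g₂`. [cite: Kudla1984, §1] -/
theorem mem_rightSummandMp_iff (p : MpPsi ρT) :
    p ∈ rightSummandMp e T₁ T₂ hT hl hb ↔ ∃ g₂ : Sp₂, spInr e T₁ T₂ hT g₂ = MpPsi.proj ρT p := by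
  simp only [rightSummandMp, Subgroup.mem_comap, MonoidHom.mem_range]

/-- the second block `g₂` of `π p = 1 ⊕ g₂` (unique, `spInr` being injective). [cite: Kudla1984, §1] -/
def rightProj (p : rightSummandMp e T₁ T₂ hT hl hb) : Sp₂ :=
  Classical.choose ((mem_rightSummandMp_iff e T₁ T₂ hT hl hb _).1 p.2)

/-- `1 ⊕ rightProj p = π p`. [cite: Kudla1984, §1] -/
theorem spInr_rightProj (p : rightSummandMp e T₁ T₂ hT hl hb) :
    spInr e T₁ T₂ hT (rightProj e T₁ T₂ hT hl hb p) = MpPsi.proj ρT (p : MpPsi ρT) :=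
  Classical.choose_spec ((mem_rightSummandMp_iff e T₁ T₂ hT hl hb _).1 p.2)

include hT₁ hψ hb₁ in
/-- existence of the stripped pair for `p ∈ rightSummandMp`. [cite: MoeglinVignerasWaldspurger1987, Chap. 2 II.1 Rem. (6)] -/
theorem stripRight_exists (p : rightSummandMp e T₁ T₂ hT hl hb) :
    ∃ p₂ : MpPsi ρ₂, (p₂ : Sp₂ × (SB₂ ≃ₗ[ℂ] SB₂)).1 = rightProj e T₁ T₂ hT hl hb p ∧
      ∀ (f₁ : SB₁) (f₂ : SB₂), ((p : MpPsi ρT) : SpT × (SB ≃ₗ[ℂ] SB)).2 (boxSB K e f₁ f₂) =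
        boxSB K e f₁ ((p₂ : Sp₂ × (SB₂ ≃ₗ[ℂ] SB₂)).2 f₂) :=
  exists_strip_of_proj_eq_spInr e T₁ T₂ hT hT₁ hl hψ hb₁ hb₂ hb _ _ (spInr_rightProj e T₁ T₂ hT hl hb p).symm

/-- **the stripped pair** `stripRight p ∈ S̃p_ψ(W_{T₂})` of `p ∈ rightSummandMp` (a choice, pinned by `eq_stripRight`).
[cite: MoeglinVignerasWaldspurger1987, Chap. 2 II.1 Rem. (6)] -/
def stripRight (p : rightSummandMp e T₁ T₂ hT hl hb) : MpPsi ρ₂ :=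
  Classical.choose (stripRight_exists e T₁ T₂ hT hT₁ hl hψ hb₁ hb₂ hb p)

/-- `π(stripRight p) = rightProj p`. [cite: MoeglinVignerasWaldspurger1987, Chap. 2 II.1 Rem. (6)] -/
theorem proj_stripRight (p : rightSummandMp e T₁ T₂ hT hl hb) :
    MpPsi.proj ρ₂ (stripRight e T₁ T₂ hT hT₁ hl hψ hb₁ hb₂ hb p) = rightProj e T₁ T₂ hT hl hb p :=
  (Classical.choose_spec (stripRight_exists e T₁ T₂ hT hT₁ hl hψ hb₁ hb₂ hb p)).1

/-- **`1 ⊕ π(stripRight p) = π p`.** [cite: Kudla1984, §1] -/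
theorem spInr_proj_stripRight (p : rightSummandMp e T₁ T₂ hT hl hb) :
    spInr e T₁ T₂ hT (MpPsi.proj ρ₂ (stripRight e T₁ T₂ hT hT₁ hl hψ hb₁ hb₂ hb p)) = MpPsi.proj ρT (p : MpPsi ρT) := by
  rw [proj_stripRight, spInr_rightProj]

/-- **`ω(p)(f₁ ⊠ f₂) = f₁ ⊠ ω(stripRight p) f₂`.** [cite: MoeglinVignerasWaldspurger1987, Chap. 2 II.1 Rem. (6)] -/
theorem toRep_apply_boxSB_right (p : rightSummandMp e T₁ T₂ hT hl hb) (f₁ : SB₁) (f₂ : SB₂) :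
    MpPsi.toRep ρT (p : MpPsi ρT) (boxSB K e f₁ f₂) =
      boxSB K e f₁ (MpPsi.toRep ρ₂ (stripRight e T₁ T₂ hT hT₁ hl hψ hb₁ hb₂ hb p) f₂) := by
  rw [MpPsi.toRep_apply, MpPsi.toRep_apply]
  exact (Classical.choose_spec (stripRight_exists e T₁ T₂ hT hT₁ hl hψ hb₁ hb₂ hb p)).2 f₁ f₂

include hT₁ hψ hb₁ in
/-- **uniqueness of the stripped pair**: any `q ∈ S̃p_ψ(W_{T₂})` with `1 ⊕ π q = π p` and
`ω(p)(f₁ ⊠ f₂) = f₁ ⊠ ω(q) f₂` is `stripRight p`. [cite: MoeglinVignerasWaldspurger1987, Chap. 2 II.1 Rem. (6)] -/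
theorem eq_stripRight (p : rightSummandMp e T₁ T₂ hT hl hb) (q : MpPsi ρ₂)
    (hq : spInr e T₁ T₂ hT (MpPsi.proj ρ₂ q) = MpPsi.proj ρT (p : MpPsi ρT))
    (hω : ∀ (f₁ : SB₁) (f₂ : SB₂), MpPsi.toRep ρT (p : MpPsi ρT) (boxSB K e f₁ f₂) = boxSB K e f₁ (MpPsi.toRep ρ₂ q f₂)) :
    q = stripRight e T₁ T₂ hT hT₁ hl hψ hb₁ hb₂ hb p := by
  obtain ⟨f₁, hf₁⟩ := exists_schwartzBruhat_pi_ne_zero K ι₁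
  have h1 : MpPsi.proj ρ₂ q = MpPsi.proj ρ₂ (stripRight e T₁ T₂ hT hT₁ hl hψ hb₁ hb₂ hb p) :=
    spInr_injective e T₁ T₂ hT (hq.trans (spInr_proj_stripRight e T₁ T₂ hT hT₁ hl hψ hb₁ hb₂ hb p).symm)
  have h2 : ((q : Sp₂ × (SB₂ ≃ₗ[ℂ] SB₂)).2 : SB₂ →ₗ[ℂ] SB₂) =
      ((stripRight e T₁ T₂ hT hT₁ hl hψ hb₁ hb₂ hb p : Sp₂ × (SB₂ ≃ₗ[ℂ] SB₂)).2 : SB₂ →ₗ[ℂ] SB₂) := by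
    refine strip_unique_right e hf₁ fun f₂ => ?_
    rw [LinearEquiv.coe_coe, LinearEquiv.coe_coe, ← MpPsi.toRep_apply, ← MpPsi.toRep_apply, ← hω,
      toRep_apply_boxSB_right e T₁ T₂ hT hT₁ hl hψ hb₁ hb₂ hb]
  exact Subtype.ext (Prod.ext h1 (LinearEquiv.toLinearMap_injective h2))

set_option maxHeartbeats 400000 in
include hT₁ hψ hb₁ in
/-- `stripRight (p q) = stripRight p · stripRight q` (uniqueness). [cite: MoeglinVignerasWaldspurger1987, Chap. 2 II.1 Rem. (6)] -/
theorem stripRight_mul (p q : rightSummandMp e T₁ T₂ hT hl hb) :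
    stripRight e T₁ T₂ hT hT₁ hl hψ hb₁ hb₂ hb (p * q) =
      stripRight e T₁ T₂ hT hT₁ hl hψ hb₁ hb₂ hb p * stripRight e T₁ T₂ hT hT₁ hl hψ hb₁ hb₂ hb q := by
  symm
  refine eq_stripRight e T₁ T₂ hT hT₁ hl hψ hb₁ hb₂ hb _ _ ?_ fun f₁ f₂ => ?_
  · have e1 := (MpPsi.proj ρ₂).map_mul (stripRight e T₁ T₂ hT hT₁ hl hψ hb₁ hb₂ hb p)
      (stripRight e T₁ T₂ hT hT₁ hl hψ hb₁ hb₂ hb q)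
    exact (congrArg (spInr e T₁ T₂ hT) e1).trans ((((spInr e T₁ T₂ hT).map_mul _ _).trans
      (congrArg₂ (· * ·) (spInr_proj_stripRight e T₁ T₂ hT hT₁ hl hψ hb₁ hb₂ hb p)
        (spInr_proj_stripRight e T₁ T₂ hT hT₁ hl hψ hb₁ hb₂ hb q))).trans ((MpPsi.proj ρT).map_mul _ _).symm)
  · have h1 := LinearMap.congr_fun ((MpPsi.toRep ρT).map_mul (p : MpPsi ρT) (q : MpPsi ρT)) (boxSB K e f₁ f₂)
    have h2 := LinearMap.congr_fun ((MpPsi.toRep ρ₂).map_mul (stripRight e T₁ T₂ hT hT₁ hl hψ hb₁ hb₂ hb p)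
      (stripRight e T₁ T₂ hT hT₁ hl hψ hb₁ hb₂ hb q)) f₂
    refine h1.trans ?_
    rw [h2, Module.End.mul_apply, Module.End.mul_apply, toRep_apply_boxSB_right e T₁ T₂ hT hT₁ hl hψ hb₁ hb₂ hb q,
      toRep_apply_boxSB_right e T₁ T₂ hT hT₁ hl hψ hb₁ hb₂ hb p]

/-- **THE RIGHT STRIPPING HOMOMORPHISM `rightSummandMp →* S̃p_ψ(W_{T₂})`.**
[cite: MoeglinVignerasWaldspurger1987, Chap. 2 II.1 Rem. (6)] -/
def stripRightHom : rightSummandMp e T₁ T₂ hT hl hb →* MpPsi ρ₂ :=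
  MonoidHom.mk' (stripRight e T₁ T₂ hT hT₁ hl hψ hb₁ hb₂ hb) (stripRight_mul e T₁ T₂ hT hT₁ hl hψ hb₁ hb₂ hb)

/-- unfolding. [cite: MoeglinVignerasWaldspurger1987, Chap. 2 II.1 Rem. (6)] -/
@[simp] theorem stripRightHom_apply (p : rightSummandMp e T₁ T₂ hT hl hb) :
    stripRightHom e T₁ T₂ hT hT₁ hl hψ hb₁ hb₂ hb p = stripRight e T₁ T₂ hT hT₁ hl hψ hb₁ hb₂ hb p := rfl

/-! ### undoubling a homomorphism over `g ↦ 1 ⊕ φ(g)` -/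

variable {G : Type*} [Group G] (φ : G →* symplecticGroup (polar (Matrix.toLinearMap₂' K T₂)))
  (s : G →* MpPsi (schrodingerSB (Matrix.toLinearMap₂' K T) ψ hl hb))
  (hs : ∀ g : G, MpPsi.proj (schrodingerSB (Matrix.toLinearMap₂' K T) ψ hl hb) (s g) = spInr e T₁ T₂ hT (φ g))

include hs in
/-- `s` takes values in `rightSummandMp`. [cite: Kudla1984, §1] -/
theorem mem_rightSummandMp_of_proj_eq (g : G) : s g ∈ rightSummandMp e T₁ T₂ hT hl hb :=
  (mem_rightSummandMp_iff e T₁ T₂ hT hl hb _).2 ⟨φ g, (hs g).symm⟩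

/-- **UNDOUBLING (right summand)**: a homomorphism `s : G →* S̃p_ψ(W_T)` over `g ↦ 1 ⊕ φ(g)` strips to
`G →* S̃p_ψ(W_{T₂})` (`stripRightHom ∘ s`). [cite: MoeglinVignerasWaldspurger1987, Chap. 2 II.1 Rem. (6)] -/
def undoubleRight : G →* MpPsi ρ₂ :=
  (stripRightHom e T₁ T₂ hT hT₁ hl hψ hb₁ hb₂ hb).comp
    (s.codRestrict (rightSummandMp e T₁ T₂ hT hl hb) (mem_rightSummandMp_of_proj_eq e T₁ T₂ hT hl hb φ s hs))

/-- **`undoubleRight s` lies over `φ`**: `π(undoubleRight s g) = φ(g)`. [cite: MoeglinVignerasWaldspurger1987, Chap. 2 II.1 Rem. (6)] -/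
theorem proj_undoubleRight (g : G) :
    MpPsi.proj ρ₂ (undoubleRight e T₁ T₂ hT hT₁ hl hψ hb₁ hb₂ hb φ s hs g) = φ g := by
  refine spInr_injective e T₁ T₂ hT ?_
  rw [undoubleRight, MonoidHom.comp_apply, stripRightHom_apply, spInr_proj_stripRight, MonoidHom.codRestrict_apply, hs]

set_option maxHeartbeats 400000 in
/-- **`ω(s g)(f₁ ⊠ f₂) = f₁ ⊠ ω(undoubleRight s g) f₂`**: the representation along `s`, restricted to the second
variables, IS the representation along `undoubleRight s` (times the identity on the first).
[cite: MoeglinVignerasWaldspurger1987, Chap. 2 II.1 Rem. (6)] -/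
theorem toRep_apply_boxSB_undoubleRight (g : G) (f₁ : SB₁) (f₂ : SB₂) :
    MpPsi.toRep ρT (s g) (boxSB K e f₁ f₂) =
      boxSB K e f₁ (MpPsi.toRep ρ₂ (undoubleRight e T₁ T₂ hT hT₁ hl hψ hb₁ hb₂ hb φ s hs g) f₂) := by
  rw [undoubleRight, MonoidHom.comp_apply, stripRightHom_apply, ← toRep_apply_boxSB_right, MonoidHom.codRestrict_apply]

end Strip

end Literature.RepresentationTheory.HeisenbergGroup

end
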